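import Literature.Computability.AlgebraicComplexity.GKKP11Lemma5Proofs
import HarnessLib

/-!
# GKKP 2011, Theorem 6 AS PRINTED (green size = skinny size of `min(C)`, Def. 7 unfolded)

[cite: GrenetEtAl2011, Thm 6] — B. Grenet, E. L. Kaltofen, P. Koiran, N. Portier, *Symmetric
determinantal representation of weakly-skew circuits*, Contemp. Math. 556 (2011) =
arXiv:1007.3804, §3.3 (held text `paper:arxiv-1007.3804`): Definition 7 (p0014:L53–L55) "the
circuit `C'` obtained in Lemma 5 is the minimized circuit associated to `C`, and written `min(C)`.
The green size of `C` is equal to the skinny size of `min(C)`", and Theorem 6 (p0014:L63–L65)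
"Let `f` be a polynomial computable by a weighted weakly skew circuit of green size `e` and with
`i` inputs labelled by a variable. Then there exists a symmetric matrix `A` of dimensions at most
`2(e+i)+1` whose entries are inputs of the circuit and elements of `{0,1,-1,1/2}` such that
`f = det A`."

The tree typed Theorem 6 as the named fact `GKKP2011_thm6` over MINIMIZED circuits (the content
of its proof, which begins "The first step is to use Lemma 5 to minimize the circuit") and
Lemma 5 as `GKKP2011_lemma5`; both are now theorems (`GKKP2011_thm6_holds`, t16 g2, and
`GKKP2011_lemma5_holds`, `GKKP11Lemma5Proofs.lean`). This theorem-only file assembles the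
PRINTED sentence for an ARBITRARY weighted weakly-skew circuit `C`, with `min(C)` =
`GKKP2011.Lemma5.minimize C` (the tree's realisation of the rewriting procedure) and the green
size read as the skinny size of that circuit:

* `GKKP2011.Thm6.isInput_of_isInput_minimize` — the inputs of `min(C)` are inputs of `C` or the
  constant `1` (Lemma 5 (i)), so "entries are inputs of the circuit" transfers;
* `GKKP2011.Thm6.exists_symm_green` — Theorem 6 as printed, matrix form, for `C` computing a
  non-constant polynomial (the standing assumption of Lemma 5's proof; entry set as in the typed
  fact: inputs of `C` or constants of `k` — the entry-set erratum recorded with `GKKP2011_thm6`);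
* `GKKP2011.Thm6.symmDeterminantalComplexity_le_green` — tree vocabulary:
  `sdc(f) ≤ 2(e+i)+1` with `e` = skinny size of `min(C)`, for EVERY weighted weakly-skew `C`
  over a field with `2 ≠ 0` (constant `f`: the `1 × 1` matrix `(f)`);
* `GKKP2011.Thm6.symmDeterminantalComplexity_le_skinny` — the weaker intrinsic bound
  `sdc(f) ≤ 2(s+i)+1` with `s` the skinny size of `C` itself (Lemma 5: `min(C)` has at most as
  many computation gates).

No definitions, no named facts, no `sorry` (D-0026). Honest framing: a bookkeeping assembly of two
discharged literature results for rung V1 of the `ValiantsHypothesis` ladder; `VP ≠ VNP` is NOT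
proved and nothing here is progress on it.
-/

namespace Literature.Computability.AlgebraicComplexity

namespace GKKP2011

namespace Thm6

open MvPolynomial

section Inputs

variable {k : Type*} [Field k] {σ : Type*} (C : Circuit k σ)

/-- **The inputs of `min(C)` are inputs of `C` or the constant `1`** (Lemma 5 (i): the only
constant inputs of the minimized circuit are fresh inputs `1`; its variable inputs are the copies
of the variable inputs of `C`, with the same labels). [cite: GrenetEtAl2011, Lemma 5 (i)] -/
theorem isInput_of_isInput_minimize (hwf : C.WellFormed) {p : MvPolynomial σ k}
    (h : (Lemma5.minimize C).IsInput p) : C.IsInput p ∨ p = MvPolynomial.C 1 := by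
  obtain ⟨hI, hS⟩ := Lemma5.sinv_run C hwf
  obtain ⟨g, hg, hgp⟩ := h
  obtain ⟨n, hn⟩ := List.getElem?_of_mem hg
  change (Lemma5.run C.gates).out[n]? = some g at hn
  cases g with
  | var y =>
    change p = X y at hgp
    subst hgp
    -- a variable input of `min(C)` is the copy of a variable input of `C`
    rcases hS.cover n (List.getElem?_eq_some_iff.1 hn).1 with ⟨q, hq⟩ | ⟨c, hc⟩
    · obtain ⟨g₀, hg₀, hsh⟩ := hS.shape q n hq
      cases g₀ with
      | var y₀ =>
        simp only [Lemma5.Shape] at hsh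
        rw [hn] at hsh
        simp only [Option.some.injEq, Node.var.injEq] at hsh
        subst hsh
        exact Or.inl ⟨.var y, List.mem_of_getElem? hg₀, rfl⟩
      | const c => exact hsh.elim
      | add c₁ i c₂ j =>
        simp only [Lemma5.Shape] at hsh
        rcases hsh with ⟨_, _, -, -, h3⟩ | ⟨_, _, _, -, -, -, -, h3⟩ | ⟨_, _, _, -, -, -, -, h3⟩ <;>
          rw [hn] at h3 <;> simp at h3
      | mul c₁ i c₂ j =>
        simp only [Lemma5.Shape] at hsh
        rcases hsh with ⟨_, _, -, -, h3⟩ | ⟨_, _, _, -, -, -, -, h3⟩ | ⟨_, _, _, -, -, -, -, h3⟩ <;>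
          rw [hn] at h3 <;> simp at h3
    · rw [hn] at hc
      simp at hc
  | const c =>
    change p = MvPolynomial.C c at hgp
    subst hgp
    obtain ⟨hc1, -, -⟩ := hS.fresh n c hn
    subst hc1
    exact Or.inr rfl
  | add c₁ i c₂ j => exact hgp.elim
  | mul c₁ i c₂ j => exact hgp.elim

end Inputs

section Printed

variable {k : Type} [Field k] {σ : Type} (C : Circuit k σ)

/-- **GKKP Theorem 6 as printed (matrix form).** For a weighted weakly-skew circuit `C` over a
field with `2 ≠ 0` computing a non-constant polynomial `f`, with `i` inputs labelled by a
variable and green size `e` = skinny size of `min(C)` (Def. 7): there is a symmetric matrix of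
dimensions at most `2(e+i)+1`, with entries inputs of `C` or constants of `k` (entry-set erratum
as recorded with `GKKP2011_thm6`), whose determinant is `f`. Obtained from `GKKP2011_thm6_holds`
applied to `min(C)` ("The first step is to use Lemma 5 to minimize the circuit", p0015:L1) and
`GKKP2011_lemma5_holds`' components. [cite: GrenetEtAl2011, Thm 6] -/
theorem exists_symm_green (h2 : (2 : k) ≠ 0) (hws : C.IsWeaklySkew)
    (hnc : ∀ c : k, C.eval ≠ MvPolynomial.C c) :
    ∃ N ≤ 2 * ((Lemma5.minimize C).skinnySize + C.numVarInputs) + 1,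
      ∃ A : Matrix (Fin N) (Fin N) (MvPolynomial σ k),
        A.IsSymm ∧ (∀ a b, C.IsInput (A a b) ∨ ∃ c : k, A a b = MvPolynomial.C c) ∧
        A.det = C.eval := by
  have hwf : C.WellFormed := hws.1.1
  obtain ⟨N, hN, A, hsymm, hent, hdet⟩ := GKKP2011_thm6_holds k h2 σ (Lemma5.minimize C)
    (Lemma5.isWeaklySkew_minimize C hws hnc) (Lemma5.isMinimized_minimize C hwf)
  refine ⟨N, ?_, A, hsymm, fun a b => ?_, ?_⟩
  · rw [Lemma5.numVarInputs_minimize C hwf] at hN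
    exact hN
  · rcases hent a b with h | ⟨c, hc⟩
    · rcases isInput_of_isInput_minimize C hwf h with h' | h'
      · exact Or.inl h'
      · exact Or.inr ⟨1, h'⟩
    · exact Or.inr ⟨c, hc⟩
  · rw [hdet, Lemma5.eval_minimize C hwf hws.1.2.1 hnc]

/-- **GKKP Theorem 6 as printed, in the tree's vocabulary**: `sdc(f) ≤ 2(e+i)+1` for every `f`
computed by a weighted weakly-skew circuit with `i` variable inputs and green size `e` (= skinny
size of `min(C)`), over a field with `2 ≠ 0`. (A constant `f` — outside Lemma 5's standing
assumption — is the determinant of the `1 × 1` matrix `(f)`.) [cite: GrenetEtAl2011, Thm 6] -/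
theorem symmDeterminantalComplexity_le_green (h2 : (2 : k) ≠ 0) (hws : C.IsWeaklySkew) :
    symmDeterminantalComplexity C.eval ≤
      2 * ((Lemma5.minimize C).skinnySize + C.numVarInputs) + 1 := by
  by_cases hc : ∃ c : k, C.eval = MvPolynomial.C c
  · obtain ⟨c, hc⟩ := hc
    have h1 : HasSymmDetRepr C.eval 1 := by
      refine ⟨Matrix.diagonal fun _ => MvPolynomial.C c, Matrix.isSymm_diagonal _, fun i j => ?_,
        ?_⟩
      · rw [Matrix.diagonal_apply]
        split_ifs
        · rw [totalDegree_C]; exact Nat.zero_le _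
        · rw [totalDegree_zero]; exact Nat.zero_le _
      · rw [Matrix.det_diagonal, hc]
        simp
    exact (symmDeterminantalComplexity_le h1).trans (by omega)
  · have hnc : ∀ c : k, C.eval ≠ MvPolynomial.C c := fun c h => hc ⟨c, h⟩
    obtain ⟨N, hN, A, hsymm, hent, hdet⟩ := exists_symm_green C h2 hws hnc
    refine (symmDeterminantalComplexity_le ⟨A, hsymm, fun i j => ?_, hdet⟩).trans hN
    rcases hent i j with h | ⟨c, hc⟩
    · exact h.totalDegree_le_one
    · rw [hc, totalDegree_C]; exact Nat.zero_le _

/-- **Weaker intrinsic form**: `sdc(f) ≤ 2(s+i)+1` with `s` the skinny size (number of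
computation gates) and `i` the number of variable inputs of ANY weighted weakly-skew circuit for
`f`, over a field with `2 ≠ 0` — since `min(C)` has at most as many computation gates as `C`
(Lemma 5). [cite: GrenetEtAl2011, Thm 6] -/
theorem symmDeterminantalComplexity_le_skinny (h2 : (2 : k) ≠ 0) (hws : C.IsWeaklySkew) :
    symmDeterminantalComplexity C.eval ≤ 2 * (C.skinnySize + C.numVarInputs) + 1 := by
  have h := Lemma5.skinnySize_minimize_le C hws.1.1
  exact (symmDeterminantalComplexity_le_green C h2 hws).trans (by omega)

end Printed

end Thm6

end GKKP2011

end Literature.Computability.AlgebraicComplexity
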